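import Summits.NavierStokesRegularity.FluidComputer.TubeTablePost18L
import HarnessLib

/-!
# Kernel run of the post-ramp box tube, chunks 0 … 5 (bp3 gen 16)

HONEST FRAMING: low prior, high value-of-information experiment on Tao's machine paradigm; NOT a
claim that NS blows up.

Kernel evaluations (`decide +kernel`; no `native_decide`, no extra axioms) of the in-tree tube checker
`runTube` (`P = 60`, 12 Taylor terms, cube `Rt`, read-out `CLt`) on the chunks `cPL 0 … cPL 5`
(= design chunks `cT 18 … cT 23`) of `TubeTablePost18L.lean`, each from the recorded boundary
state `sPL i` to `sPL (i+1)`.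

[cite: Tao2016AveragedNS, §5.5 Thm 5.3 (5.5)]
-/

namespace Summit.NavierStokesRegularity.FluidComputer

namespace TubeTablePost18L

open Literature.Analysis.FluidPDE.FluidComputer Literature.Analysis.FluidPDE.FluidComputer.TubeTable
open Literature.Analysis.FluidPDE.FluidComputer.ThresholdLevelTable (GIt)

set_option maxHeartbeats 10000000 in
set_option maxRecDepth 200000 in
/-- Chunk 0 of the post-ramp tube run (design chunk 18: 50 steps at `h = 2^-11`). [folklore] -/
theorem runPL_0 : runTube 60 12 GIt CLt Rt (sPL 0) (cPL 0) = some (sPL (0 + 1)) := by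
  decide +kernel

set_option maxHeartbeats 10000000 in
set_option maxRecDepth 200000 in
/-- Chunk 1 of the post-ramp tube run (design chunk 19: 50 steps at `h = 2^-11`). [folklore] -/
theorem runPL_1 : runTube 60 12 GIt CLt Rt (sPL 1) (cPL 1) = some (sPL (1 + 1)) := by
  decide +kernel

set_option maxHeartbeats 10000000 in
set_option maxRecDepth 200000 in
/-- Chunk 2 of the post-ramp tube run (design chunk 20: 50 steps at `h = 2^-11`). [folklore] -/
theorem runPL_2 : runTube 60 12 GIt CLt Rt (sPL 2) (cPL 2) = some (sPL (2 + 1)) := by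
  decide +kernel

set_option maxHeartbeats 10000000 in
set_option maxRecDepth 200000 in
/-- Chunk 3 of the post-ramp tube run (design chunk 21: 50 steps at `h = 2^-11`). [folklore] -/
theorem runPL_3 : runTube 60 12 GIt CLt Rt (sPL 3) (cPL 3) = some (sPL (3 + 1)) := by
  decide +kernel

set_option maxHeartbeats 10000000 in
set_option maxRecDepth 200000 in
/-- Chunk 4 of the post-ramp tube run (design chunk 22: 50 steps at `h = 2^-11`). [folklore] -/
theorem runPL_4 : runTube 60 12 GIt CLt Rt (sPL 4) (cPL 4) = some (sPL (4 + 1)) := by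
  decide +kernel

set_option maxHeartbeats 10000000 in
set_option maxRecDepth 200000 in
/-- Chunk 5 of the post-ramp tube run (design chunk 23: 50 steps at `h = 2^-11`). [folklore] -/
theorem runPL_5 : runTube 60 12 GIt CLt Rt (sPL 5) (cPL 5) = some (sPL (5 + 1)) := by
  decide +kernel

end TubeTablePost18L

end Summit.NavierStokesRegularity.FluidComputer
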